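import Summits.CriticalPhenomena.PercolationContinuityZ3.Theorems.PercGamblersRuinSymmetricSlabCalibration

/-!
# Route `PercGamblersRuin`, crux `VerticalGamblersRuin` (stmt-CriticalPhenomena-10642):
# stub `stub_clusterComparison` — comparison of a big-slab voltage with a lower-slab solution

Helper file for the stub `stub_clusterComparison` of the line `registered` of the crux
`PercGamblersRuin.VerticalGamblersRuin` (stmt-CriticalPhenomena-10642).

Setting: bond configurations `ω` on `ℤ³`; a *slab solution* is a function on `ℤ³` harmonic for
the OPEN lattice edges of `ω` at every site of an open horizontal slab, with Dirichlet data on the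
two plate regions.  Given a selection `v : Ω → ℤ³ → [0, 1]` of solutions of the big slab
`(-kn, (k+1)n)` (ceiling datum `1`, floor datum `0`, `ω ↦ v ω x` measurable for every site `x`)
and a level `κ > 0`, the stub produces a selection `u` of solutions of the LOWER slab `(-kn, kn)`
whose ceiling datum on `{kn ≤ x₀}` is `0` at the *bad* sites `{v ω · < κ} ∩ {· ↔ ∞}` and `1`
elsewhere, measurable at every site, with `κ · u ω 0 ≤ v ω 0` whenever `0 ↔ ∞`.

The statement is CONDITIONAL on the minimal-solution existence statement (its first hypothesis,
the neighbouring stub `stub_minimalSolution` spelled out verbatim): for a general measurable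
`[0, 1]`-valued ceiling datum `g` there is a slab solution `w`, measurable at every site, which is
minimal among nonnegative supersolutions.

Proof.  Take `u :=` the minimal solution for `A = T = kn` and the datum
`g ω x := if v ω x < κ ∧ ω ∈ percolatesAt x then 0 else 1` (measurable at every site: `v` is, and
`{x ↔ ∞}` is a measurable event, `measurableSet_percolatesAt_holds`).  For the comparison fix `ω`
with `0 ↔ ∞` and test minimality against `f x := if ω ∈ percolatesAt x then v ω x / κ else 1`:
`f ≥ 0`; `f ≥ g ω` on the ceiling region (at a percolating site either `v < κ` and `g = 0 ≤ v/κ`,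
or `v ≥ κ` and `g = 1 ≤ v/κ`; at a non-percolating site `g ≤ 1 = f`); and `f` is harmonic for the
open edges on the lower slab, because the event `{x ↔ ∞}` is CLOSED UNDER OPEN LATTICE STEPS
(`x ∼ y` open gives `C(x) = C(y)`): at a percolating interior site all open neighbours percolate
and the defect of `f` is `κ⁻¹ ·` the defect of `v ω`, which vanishes since the site is interior
to the big slab; at a non-percolating site every term is `1 - 1 = 0`.  Minimality then gives
`u ω 0 ≤ f 0 = v ω 0 / κ`.

## References

* R. Lyons, Y. Peres, *Probability on Trees and Networks*, Cambridge University Press (2016),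
  §2.1 (harmonic functions, the Dirichlet problem, minimal solutions / maximum principle).
* G. Grimmett, *Percolation*, 2nd ed., Springer (1999), §1.3–§1.4 (open clusters, `{x ↔ ∞}`).
-/

noncomputable section

namespace Summit.CriticalPhenomena.PercolationContinuityZ3.Theorems.VerticalGamblersRuin

open MeasureTheory Filter Topology
open Literature.Probability.Percolation Literature.Probability.LatticeModels
open scoped Classical

namespace StubClusterComparison

/-- The event `{x ↔ ∞}` only depends on the open cluster: if `x ↔ y` in `ω`, then `ω` percolates
at `x` iff it percolates at `y` (the clusters `C(x)` and `C(y)` coincide). -/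
theorem mem_percolatesAt_iff_of_reachable {V : Type*} {ω : BondConfig V} {x y : V}
    (h : (openGraph ω).Reachable x y) : ω ∈ percolatesAt x ↔ ω ∈ percolatesAt y := by
  have hC : openCluster ω x = openCluster ω y := by
    ext z
    exact ⟨fun hz => h.symm.trans hz, fun hz => h.trans hz⟩
  show (openCluster ω x).Infinite ↔ (openCluster ω y).Infinite
  rw [hC]

/-- Closure of `{· ↔ ∞}` under open lattice steps: if `y` is a lattice neighbour of `x` with the
edge `s(x, y)` open in `ω`, then `ω` percolates at `x` iff it percolates at `y`. -/
theorem mem_percolatesAt_iff_of_mem_filter {ω : BondConfig (Site 3)} {x y : Site 3}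
    (hy : y ∈ ((zdGraph 3).neighborFinset x).filter (fun y => s(x, y) ∈ ω)) :
    ω ∈ percolatesAt x ↔ ω ∈ percolatesAt y := by
  rw [Finset.mem_filter, SimpleGraph.mem_neighborFinset] at hy
  exact mem_percolatesAt_iff_of_reachable
    (SimpleGraph.Adj.reachable ((openGraph_adj ω x y).2 ⟨hy.2, hy.1.ne⟩))

end StubClusterComparison

open StubClusterComparison in
/-- **Stub `stub_clusterComparison`** of the crux `VerticalGamblersRuin` (line `registered`),
CONDITIONAL form.  Assume the minimal-solution statement (first hypothesis): for all `A, T` with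
`T > 0` and every ceiling datum `g : Ω → ℤ³ → [0, 1]` measurable at every site there is a slab
solution `w` on `(-A, T)` (values in `[0, 1]`, `w ω = g ω` on `{T ≤ x₀}`, `w ω = 0` on
`{x₀ ≤ -A}`, harmonic for the open lattice edges of `ω` in between), measurable at every site and
minimal among nonnegative supersolutions.  Then for `k, n > 0`, `κ > 0` and every selection `v` of
`[0, 1]`-valued solutions of the big slab `(-kn, (k+1)n)` with ceiling datum `1` and floor datum
`0`, measurable at every site, there is a selection `u` of solutions of the lower slab `(-kn, kn)`
with ceiling datum `0` at the bad sites `{v ω · < κ} ∩ {· ↔ ∞}` and `1` elsewhere, measurable at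
every site, such that `κ · u ω 0 ≤ v ω 0` whenever `0 ↔ ∞` in `ω`. -/
theorem stub_clusterComparison :
    (∀ (A T : ℕ), 0 < T → ∀ g : BondConfig (Site 3) → Site 3 → ℝ,
      (∀ x, Measurable fun ω => g ω x) → (∀ ω x, 0 ≤ g ω x ∧ g ω x ≤ 1) →
      ∃ w : BondConfig (Site 3) → Site 3 → ℝ,
        (∀ x, Measurable fun ω => w ω x) ∧
        (∀ ω, (∀ x, 0 ≤ w ω x ∧ w ω x ≤ 1) ∧
          (∀ x : Site 3, (T : ℤ) ≤ x 0 → w ω x = g ω x) ∧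
          (∀ x : Site 3, x 0 ≤ -(A : ℤ) → w ω x = 0) ∧
          ∀ x : Site 3, -(A : ℤ) < x 0 → x 0 < (T : ℤ) →
            ∑ y ∈ ((zdGraph 3).neighborFinset x).filter (fun y => s(x, y) ∈ ω), (w ω y - w ω x) = 0) ∧
        ∀ (ω : BondConfig (Site 3)) (f : Site 3 → ℝ), (∀ x, 0 ≤ f x) →
          (∀ x : Site 3, (T : ℤ) ≤ x 0 → g ω x ≤ f x) →
          (∀ x : Site 3, -(A : ℤ) < x 0 → x 0 < (T : ℤ) →
            ∑ y ∈ ((zdGraph 3).neighborFinset x).filter (fun y => s(x, y) ∈ ω), (f y - f x) = 0) →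
          ∀ x, w ω x ≤ f x) →
    ∀ (k n : ℕ) (κ : ℝ), 0 < k → 0 < n → 0 < κ →
      ∀ v : BondConfig (Site 3) → Site 3 → ℝ, (∀ x, Measurable fun ω => v ω x) →
        (∀ ω, (∀ x, 0 ≤ v ω x ∧ v ω x ≤ 1) ∧
          (∀ x : Site 3, (((k + 1) * n : ℕ) : ℤ) ≤ x 0 → v ω x = 1) ∧
          (∀ x : Site 3, x 0 ≤ -((k * n : ℕ) : ℤ) → v ω x = 0) ∧
          ∀ x : Site 3, -((k * n : ℕ) : ℤ) < x 0 → x 0 < (((k + 1) * n : ℕ) : ℤ) →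
            ∑ y ∈ ((zdGraph 3).neighborFinset x).filter (fun y => s(x, y) ∈ ω), (v ω y - v ω x) = 0) →
        ∃ u : BondConfig (Site 3) → Site 3 → ℝ,
          (∀ x, Measurable fun ω => u ω x) ∧
          (∀ ω, (∀ x, 0 ≤ u ω x ∧ u ω x ≤ 1) ∧
            (∀ x : Site 3, ((k * n : ℕ) : ℤ) ≤ x 0 →
              u ω x = if v ω x < κ ∧ ω ∈ percolatesAt x then 0 else 1) ∧
            (∀ x : Site 3, x 0 ≤ -((k * n : ℕ) : ℤ) → u ω x = 0) ∧
            ∀ x : Site 3, -((k * n : ℕ) : ℤ) < x 0 → x 0 < ((k * n : ℕ) : ℤ) →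
              ∑ y ∈ ((zdGraph 3).neighborFinset x).filter (fun y => s(x, y) ∈ ω), (u ω y - u ω x) = 0) ∧
          ∀ ω, ω ∈ percolatesAt (0 : Site 3) → κ * u ω 0 ≤ v ω 0 := by
  intro hMin k n κ hk hn hκ v hvmeas hvsol
  -- the ceiling datum `g ω x := if v ω x < κ ∧ ω ∈ percolatesAt x then 0 else 1`
  have hgmeas : ∀ x : Site 3, Measurable fun ω : BondConfig (Site 3) =>
      if v ω x < κ ∧ ω ∈ percolatesAt x then (0 : ℝ) else 1 := by
    intro x
    refine Measurable.ite ?_ measurable_const measurable_const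
    exact (measurableSet_lt (hvmeas x) measurable_const).inter
      (measurableSet_percolatesAt_holds x)
  have hg01 : ∀ (ω : BondConfig (Site 3)) (x : Site 3),
      (0 : ℝ) ≤ (if v ω x < κ ∧ ω ∈ percolatesAt x then (0 : ℝ) else 1) ∧
        (if v ω x < κ ∧ ω ∈ percolatesAt x then (0 : ℝ) else 1) ≤ 1 := by
    intro ω x
    split_ifs <;> norm_num
  -- the minimal solution of the lower slab `(-kn, kn)` with datum `g`
  obtain ⟨u, humeas, husol, humin⟩ := hMin (k * n) (k * n) (Nat.mul_pos hk hn)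
    (fun ω x => if v ω x < κ ∧ ω ∈ percolatesAt x then (0 : ℝ) else 1) hgmeas hg01
  refine ⟨u, humeas, fun ω => husol ω, fun ω hω0 => ?_⟩
  -- comparison with the supersolution `f x := if ω ∈ percolatesAt x then v ω x / κ else 1`
  have hkn : ((k * n : ℕ) : ℤ) ≤ (((k + 1) * n : ℕ) : ℤ) := by
    rw [Nat.cast_le, add_mul, one_mul]
    exact Nat.le_add_right _ _
  obtain ⟨hv01, -, -, hvharm⟩ := hvsol ω
  have hf0 : ∀ x : Site 3, (0 : ℝ) ≤ if ω ∈ percolatesAt x then v ω x / κ else 1 := by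
    intro x
    split_ifs
    · exact div_nonneg (hv01 x).1 hκ.le
    · exact zero_le_one
  have hfceil : ∀ x : Site 3, ((k * n : ℕ) : ℤ) ≤ x 0 →
      (if v ω x < κ ∧ ω ∈ percolatesAt x then (0 : ℝ) else 1) ≤
        if ω ∈ percolatesAt x then v ω x / κ else 1 := by
    intro x _
    by_cases hx : ω ∈ percolatesAt x
    · by_cases hvx : v ω x < κ
      · rw [if_pos ⟨hvx, hx⟩, if_pos hx]
        exact div_nonneg (hv01 x).1 hκ.le
      · rw [if_neg (fun h => hvx h.1), if_pos hx, le_div_iff₀ hκ, one_mul]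
        exact not_lt.1 hvx
    · rw [if_neg (fun h => hx h.2), if_neg hx]
  have hfharm : ∀ x : Site 3, -((k * n : ℕ) : ℤ) < x 0 → x 0 < ((k * n : ℕ) : ℤ) →
      ∑ y ∈ ((zdGraph 3).neighborFinset x).filter (fun y => s(x, y) ∈ ω),
        ((if ω ∈ percolatesAt y then v ω y / κ else 1) -
          (if ω ∈ percolatesAt x then v ω x / κ else 1)) = 0 := by
    intro x hlo hhi
    by_cases hx : ω ∈ percolatesAt x
    · -- every open neighbour of a percolating site percolates
      rw [if_pos hx]
      have hvx := hvharm x hlo (hhi.trans_le hkn)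
      calc ∑ y ∈ ((zdGraph 3).neighborFinset x).filter (fun y => s(x, y) ∈ ω),
              ((if ω ∈ percolatesAt y then v ω y / κ else 1) - v ω x / κ)
            = ∑ y ∈ ((zdGraph 3).neighborFinset x).filter (fun y => s(x, y) ∈ ω),
                (v ω y - v ω x) / κ := by
              refine Finset.sum_congr rfl fun y hy => ?_
              rw [if_pos ((mem_percolatesAt_iff_of_mem_filter hy).1 hx), sub_div]
        _ = 0 := by rw [← Finset.sum_div, hvx, zero_div]
    · -- no open neighbour of a non-percolating site percolates
      rw [if_neg hx]
      refine Finset.sum_eq_zero fun y hy => ?_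
      rw [if_neg (fun h => hx ((mem_percolatesAt_iff_of_mem_filter hy).2 h)), sub_self]
  have key := humin ω (fun x => if ω ∈ percolatesAt x then v ω x / κ else 1) hf0 hfceil hfharm 0
  rw [if_pos hω0, le_div_iff₀ hκ] at key
  rw [mul_comm]
  exact key

end Summit.CriticalPhenomena.PercolationContinuityZ3.Theorems.VerticalGamblersRuin
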